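import Summits.Ventures.HSemireg.WedgeHankelRecurrenceGaussChebyshevSineProduct

/-!
# Venture HSemireg — **THE HALF-ANGLE SINE AND COSINE PRODUCTS FROM `S_{n−1}(±2) = ±n`: `∏_{j=1}^{n−1} (2 − 2cos(πj∕n)) = n`, `∏_{j=1}^{n−1} (2 + 2cos(πj∕n)) = n`, hence
# `∏_{j=1}^{n−1} 2sin(πj∕2n) = √n`, `∏_{j=1}^{n−1} 2cos(πj∕2n) = √n`, i.e. `∏ sin(πj∕2n) = ∏ cos(πj∕2n) = √n ∕ 2^{n−1}`** (`n ≥ 1`) — by evaluating the real factorisation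
# `S_{n−1} = ∏_{j=1}^{n−1} (X − 2cos(πj∕n))` (N500) at `X = ±2`

HONEST FRAMING. Part of the Lean index of the computation cell `pub-hsemireg` (seat p10 gen 49, Sunday typer «UNIFORM-IN-n»).  Real polynomial evaluation and trigonometry only (Mathlib
`Polynomial.Chebyshev.S`, `Real.sin ∕ cos ∕ sqrt`); no variety, no cohomology theory, no sheaf, no Ext group and no semiregularity map is constructed here; nothing here says that HC / HC_CM / HC_AV
holds; no Literature fact (unproved `Prop`) is declared or used.  Custodian versions as in `WedgeHankelSiegelIdeal` (1/3).
SOURCES (cited).  I. S. Gradshteyn, I. M. Ryzhik, *Table of Integrals, Series, and Products*, 1.392 (`∏_{k=1}^{n−1} sin(kπ∕2n) = √n∕2^{n−1}`, `∏_{k=1}^{n−1} cos(kπ∕2n) = √n∕2^{n−1}`); T. J. Rivlin,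
*The Chebyshev Polynomials* (1974), §1.2 (`U_{n−1}(1) = n`); J. C. Mason, D. C. Handscomb, *Chebyshev Polynomials* (2003), §2.4.
PROOF TYPED HERE.  N500 `chebyshevS_eq_prod_real` at `X = 2` with Mathlib `S_eval_two` (`S_{n−1}(2) = n`) gives the first product; the second by the reflection `j ↦ n − j`
(`cos(π − θ) = −cos θ`, `Finset.prod_range_reflect`); then `2 ∓ 2cos 2α = 4sin² α ∕ 4cos² α`, positivity of `sin`, `cos` on `(0, π∕2)`, and `Real.sqrt_sq`.
DEDUP DISCLOSURE (`rg -n 'prod_sin|prod_cos|sin_pi_div_two_mul' Summits Literature`, `lean search`, 2026-09-04): N510 has the full-angle product `∏ sin(πj∕n) = n∕2^{n−1}`; N47x-era leaves have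
`∏ cos((2k+1)π∕2(t+1))` as `±2^{−t}T_{t+1}(0)`; the half-angle products below are in neither Mathlib nor the tree; 0 hits for the 8 names below.

WHAT IS IN THE TREE.  N500 `chebyshevS_eq_prod_real`; N510 (method); Mathlib `S_eval_two`, `Real.cos_pi_sub`, `Real.cos_two_mul`, `Real.cos_sq'`, `Real.sqrt_sq`, `Finset.prod_range_reflect`.
THIS FILE (namespace `Summit.Ventures.HSemireg.Wedge.HankelOuter` continued; CHAINED on N510; 0 definitions):
* §1276 **`prod_two_sub_two_mul_cos_half_eq`** (`∏_{j=1}^{n−1} (2 − 2cos(πj∕n)) = n`), **`prod_two_add_two_mul_cos_half_eq`** (`∏ (2 + 2cos(πj∕n)) = n`), `prod_four_mul_sin_sq_half_eq`,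
  `prod_four_mul_cos_sq_half_eq`, **`prod_two_mul_sin_half_eq_sqrt`** (`∏ 2sin(πj∕2n) = √n`), **`prod_two_mul_cos_half_eq_sqrt`** (`∏ 2cos(πj∕2n) = √n`), **`prod_sin_pi_div_two_mul_eq`**,
  **`prod_cos_pi_div_two_mul_eq`** (`= √n ∕ 2^{n−1}`).
CAVEATS.  `n ≥ 1`; products over `j ∈ [1, n−1]` are written over `Finset.range (n − 1)` with the shift `j + 1`.  Nothing Ext-side.  New names only.
-/

open Module Polynomial
open scoped Matrix Polynomial

namespace Summit.Ventures.HSemireg.Wedge.HankelOuter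

/-! ## §1276. Half-angle sine and cosine products -/

/-- **`∏_{j=1}^{n−1} (2 − 2cos(πj∕n)) = n`** (`n ≥ 1`; `= S_{n−1}(2)`). [Rivlin §1.2 (`U_{n−1}(1) = n`); this file, §1276] -/
theorem prod_two_sub_two_mul_cos_half_eq {n : ℕ} (hn : n ≠ 0) : ∏ j ∈ Finset.range (n - 1), (2 - 2 * Real.cos ((j + 1 : ℕ) * (Real.pi / n))) = (n : ℝ) := by
  obtain ⟨m, rfl⟩ := Nat.exists_eq_add_one_of_ne_zero hn
  rw [Nat.add_sub_cancel]
  have h := congrArg (Polynomial.eval (2 : ℝ)) (chebyshevS_eq_prod_real m)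
  rw [Polynomial.Chebyshev.S_eval_two, Int.cast_natCast, eval_prod] at h
  rw [Nat.cast_add_one]
  refine Eq.trans (Finset.prod_congr rfl fun j _ => ?_) h.symm
  have hθ : ((j + 1 : ℕ) : ℝ) * (Real.pi / ((m : ℝ) + 1)) = ((j : ℝ) + 1) * Real.pi / ((m : ℝ) + 1) := by push_cast; ring
  rw [eval_sub, eval_X, eval_C, hθ]

/-- **`∏_{j=1}^{n−1} (2 + 2cos(πj∕n)) = n`** (`n ≥ 1`; reflection `j ↦ n − j`). [Rivlin §1.2; this file, §1276] -/
theorem prod_two_add_two_mul_cos_half_eq {n : ℕ} (hn : n ≠ 0) : ∏ j ∈ Finset.range (n - 1), (2 + 2 * Real.cos ((j + 1 : ℕ) * (Real.pi / n))) = (n : ℝ) := by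
  rw [← Finset.prod_range_reflect (fun j => 2 + 2 * Real.cos ((j + 1 : ℕ) * (Real.pi / n))) (n - 1)]
  refine Eq.trans (Finset.prod_congr rfl fun j hj => ?_) (prod_two_sub_two_mul_cos_half_eq hn)
  have hj := Finset.mem_range.mp hj
  have hnR : (n : ℝ) ≠ 0 := by exact_mod_cast hn
  have hidx : (((n - 1 - 1 - j + 1 : ℕ)) : ℝ) * (Real.pi / n) = Real.pi - ((j + 1 : ℕ) : ℝ) * (Real.pi / n) := by
    rw [show n - 1 - 1 - j + 1 = n - (j + 1) by omega, Nat.cast_sub (by omega)]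
    field_simp
  rw [hidx, Real.cos_pi_sub]
  ring

/-- `∏_{j=1}^{n−1} 4sin²(πj∕2n) = n` (`n ≥ 1`). [Gradshteyn–Ryzhik 1.392; this file, §1276] -/
theorem prod_four_mul_sin_sq_half_eq {n : ℕ} (hn : n ≠ 0) : ∏ j ∈ Finset.range (n - 1), 4 * Real.sin ((j + 1 : ℕ) * (Real.pi / (2 * n))) ^ 2 = (n : ℝ) := by
  refine Eq.trans (Finset.prod_congr rfl fun j _ => ?_) (prod_two_sub_two_mul_cos_half_eq hn)
  have hθ : ((j + 1 : ℕ) : ℝ) * (Real.pi / n) = 2 * (((j + 1 : ℕ) : ℝ) * (Real.pi / (2 * n))) := by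
    have hnR : (n : ℝ) ≠ 0 := by exact_mod_cast hn
    field_simp
  rw [hθ, Real.cos_two_mul, Real.cos_sq']
  ring

/-- `∏_{j=1}^{n−1} 4cos²(πj∕2n) = n` (`n ≥ 1`). [Gradshteyn–Ryzhik 1.392; this file, §1276] -/
theorem prod_four_mul_cos_sq_half_eq {n : ℕ} (hn : n ≠ 0) : ∏ j ∈ Finset.range (n - 1), 4 * Real.cos ((j + 1 : ℕ) * (Real.pi / (2 * n))) ^ 2 = (n : ℝ) := by
  refine Eq.trans (Finset.prod_congr rfl fun j _ => ?_) (prod_two_add_two_mul_cos_half_eq hn)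
  have hθ : ((j + 1 : ℕ) : ℝ) * (Real.pi / n) = 2 * (((j + 1 : ℕ) : ℝ) * (Real.pi / (2 * n))) := by
    have hnR : (n : ℝ) ≠ 0 := by exact_mod_cast hn
    field_simp
  rw [hθ, Real.cos_two_mul]
  ring

/-- The half angles `πj∕2n`, `1 ≤ j ≤ n − 1`, lie in `(0, π∕2)`. [bookkeeping; this file, §1276] -/
theorem angle_quarter_mem {j n : ℕ} (hj : j < n - 1) : 0 < ((j + 1 : ℕ) : ℝ) * (Real.pi / (2 * n)) ∧ ((j + 1 : ℕ) : ℝ) * (Real.pi / (2 * n)) < Real.pi / 2 := by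
  have hnR : (0 : ℝ) < n := by exact_mod_cast (by omega : 0 < n)
  refine ⟨by positivity, ?_⟩
  rw [mul_div_assoc', div_lt_div_iff₀ (by positivity) two_pos]
  have : ((j + 1 : ℕ) : ℝ) < n := by exact_mod_cast (by omega : j + 1 < n)
  nlinarith [Real.pi_pos]

/-- **`∏_{j=1}^{n−1} 2sin(πj∕2n) = √n`** (`n ≥ 1`). [Gradshteyn–Ryzhik 1.392; this file, §1276] -/
theorem prod_two_mul_sin_half_eq_sqrt {n : ℕ} (hn : n ≠ 0) : ∏ j ∈ Finset.range (n - 1), 2 * Real.sin ((j + 1 : ℕ) * (Real.pi / (2 * n))) = Real.sqrt n := by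
  have hnonneg : 0 ≤ ∏ j ∈ Finset.range (n - 1), 2 * Real.sin ((j + 1 : ℕ) * (Real.pi / (2 * n))) :=
    Finset.prod_nonneg fun j hj => mul_nonneg zero_le_two
      (Real.sin_pos_of_pos_of_lt_pi (angle_quarter_mem (Finset.mem_range.mp hj)).1 ((angle_quarter_mem (Finset.mem_range.mp hj)).2.trans (by linarith [Real.pi_pos]))).le
  have hsq : (∏ j ∈ Finset.range (n - 1), 2 * Real.sin ((j + 1 : ℕ) * (Real.pi / (2 * n)))) ^ 2 = n := by
    rw [← Finset.prod_pow]
    exact Eq.trans (Finset.prod_congr rfl fun j _ => by ring) (prod_four_mul_sin_sq_half_eq hn)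
  have h := Real.sqrt_sq hnonneg
  rw [hsq] at h
  exact h.symm

/-- **`∏_{j=1}^{n−1} 2cos(πj∕2n) = √n`** (`n ≥ 1`). [Gradshteyn–Ryzhik 1.392; this file, §1276] -/
theorem prod_two_mul_cos_half_eq_sqrt {n : ℕ} (hn : n ≠ 0) : ∏ j ∈ Finset.range (n - 1), 2 * Real.cos ((j + 1 : ℕ) * (Real.pi / (2 * n))) = Real.sqrt n := by
  have hnonneg : 0 ≤ ∏ j ∈ Finset.range (n - 1), 2 * Real.cos ((j + 1 : ℕ) * (Real.pi / (2 * n))) :=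
    Finset.prod_nonneg fun j hj => mul_nonneg zero_le_two
      (Real.cos_pos_of_mem_Ioo ⟨by linarith [(angle_quarter_mem (Finset.mem_range.mp hj)).1, Real.pi_pos], (angle_quarter_mem (Finset.mem_range.mp hj)).2⟩).le
  have hsq : (∏ j ∈ Finset.range (n - 1), 2 * Real.cos ((j + 1 : ℕ) * (Real.pi / (2 * n)))) ^ 2 = n := by
    rw [← Finset.prod_pow]
    exact Eq.trans (Finset.prod_congr rfl fun j _ => by ring) (prod_four_mul_cos_sq_half_eq hn)
  have h := Real.sqrt_sq hnonneg
  rw [hsq] at h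
  exact h.symm

/-- **`∏_{j=1}^{n−1} sin(πj∕2n) = √n ∕ 2^{n−1}`** (`n ≥ 1`). [Gradshteyn–Ryzhik 1.392; this file, §1276] -/
theorem prod_sin_pi_div_two_mul_eq {n : ℕ} (hn : n ≠ 0) : ∏ j ∈ Finset.range (n - 1), Real.sin ((j + 1 : ℕ) * (Real.pi / (2 * n))) = Real.sqrt n / 2 ^ (n - 1) := by
  have h := prod_two_mul_sin_half_eq_sqrt hn
  rw [Finset.prod_mul_distrib, Finset.prod_const, Finset.card_range] at h
  rw [eq_div_iff (pow_ne_zero _ two_ne_zero), mul_comm]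
  exact h

/-- **`∏_{j=1}^{n−1} cos(πj∕2n) = √n ∕ 2^{n−1}`** (`n ≥ 1`). [Gradshteyn–Ryzhik 1.392; this file, §1276] -/
theorem prod_cos_pi_div_two_mul_eq {n : ℕ} (hn : n ≠ 0) : ∏ j ∈ Finset.range (n - 1), Real.cos ((j + 1 : ℕ) * (Real.pi / (2 * n))) = Real.sqrt n / 2 ^ (n - 1) := by
  have h := prod_two_mul_cos_half_eq_sqrt hn
  rw [Finset.prod_mul_distrib, Finset.prod_const, Finset.card_range] at h
  rw [eq_div_iff (pow_ne_zero _ two_ne_zero), mul_comm]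
  exact h

end Summit.Ventures.HSemireg.Wedge.HankelOuter
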